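import Mathlib
import HarnessLib
import HarnessLib.Audit
import Summits.CriticalPhenomena.PercolationContinuityZ3.Theorems.PercNearOneGluingNoHeavyLowerTailHexMSMatchMS2

/-!
# Hall forms of the second-order Marica–Schönheim inequality, the `tops` sparsification, and two no-go witnesses (hp-7 gen 73)

Support file for crux `stmt-CriticalPhenomena-4575` (route `PercNearOneGluingNoHeavy`), hull-port seat `prim-hp-7` (generation 73);
`--supports stmt-CriticalPhenomena-4575`.  No `sorry`.  Memo: `run/shared/lean/prim/prim-hp-7/FROM-prim-hp-7-g73-MS2-HALL.md`.

The conjecture (MS2) (`MS2`, file `…HexMSMatchMS2`; the official pure target of the depth-one layer of (MATCH*)) asks for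
`#(F ∪ D₅ ∪ D₂) ≤ #(F \\ F ∪ P \\ D₅ ∪ Q \\ D₂)`.  Gen 73 found (memo §0) that it is the `A = F` case of two HALL CONDITIONS
(H1′), (H2′); both survived random sampling (`n ≤ 6`) and all structured MS-tight 'twisted product' families (`n ≤ 6`), but the exact
SAT census (kit `j275653`) then decided: **(H1′) holds exactly on `2^[3]`, `2^[4]`** (general; `2^[5]` for dead-like blocks), while
**(H2′) is FALSE on `2^[4]`** (`not_ms2Hall_fin4` below, ADDED after the census; it is still exact for dead-like blocks on `2^[≤5]`):

* `MS2Hall α` — **(H2′)** (REFUTED in general, see `not_ms2Hall_fin4`; open for dead-like blocks): for every `A ⊆ F`, `#(A ∪ D₅ ∪ D₂) ≤ #(F \\ A ∪ (D₅ ∪ D₂) ∪ P \\ D₅ ∪ Q \\ D₂)` — Hall's condition for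
  the bipartite graph in which a member `a` may be paid by any `f \ a` (`f ∈ F`) and a designated difference `d` by itself or by a
  second difference `m \ d` with `m` in `d`'s own block; so (H2′) says that (MS2) is witnessed by an INJECTION (a system of
  distinct representatives).  `D = ∅` is the Aharoni–Holzman complement form `#ℬ ≤ #(𝒜 \\ ℬ)`.
* `MS2Hall' α` — **(H1′)**: the same with `A \\ F` (members paid by `a \ f`); `D = ∅` is Ahlswede–Daykin's Theorem 37.
* `ms2_of_ms2Hall`, `ms2_of_ms2Hall'` — either Hall form implies `MS2` (take `A = F`; `D ⊆ F \\ F`).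
* `MS2Tops α` — **the `tops` sparsification** (memo §0 (V1)): only second differences `t \ d` whose minuend `t` is a TOP of some
  designated difference of the same type (`t ∈ P` with `t \ q ∈ D₅` for some `q ∈ Q`) are needed; `ms2_of_ms2Tops : MS2Tops α → MS2 α`.
  (In every sampled instance the graph with these sparser neighbourhoods still has a perfect matching; restricting further to
  tops CONTAINING `d` — the 'corner form' — is false, `not_ms2Corner_fin4` below.)
* `not_ms2Corner_fin4` — **no-go**: the corner form (witnesses `p ∩ q` of realising pairs only) fails for the MS-tight twisted
  product `P = {123, 124, 12}`, `Q = {2, 23, 24}`, `D₅ = {13, 14}` on `Fin 4` (`7 < 8`), although (MS2) holds there via `124 \ 13 = 24`.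
* `ms2_sectioning_obstruction_fin3` — **no-go for coordinate induction**: for the (MS2)-tight instance `P = {{1,2}}`,
  `Q = {{0,1}}`, `D₅ = {{2}}`, `D₂ = {{0}}` on `Fin 3` (term family `T = {∅,{2},{0},{1}}`, paid family `R = {{1,2},{0,1},{2},{0}}`,
  `#T = #R = 4`), at EVERY coordinate `i` either the `i`-traces of `T` are fewer than those of `R` or the `i`-pairs inside `T` are
  fewer than those inside `R`.  Since every Ahlswede–Daykin / Aharoni–Holzman style sectioning proof bounds traces by traces and
  pairs by pairs at some coordinate, NO such induction can prove (MS2) — for any inductive class and any choice of coordinate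
  (memo §0 NOGO-1; dead-like instances reduce to this one by deleting an unused coordinate).
-/

namespace Summit.CriticalPhenomena.PercolationContinuityZ3.Theorems

namespace GeneratedDonors

open Finset FinsetFamily

variable {α : Type*} [DecidableEq α]

section HallForms

/-- **Conjecture (H2′)** (hp-7 gen 73), the subtrahend Hall form of (MS2).  An obligation, not a fact. -/
def MS2Hall (α : Type*) [DecidableEq α] : Prop :=
  ∀ (P Q A D₅ D₂ : Finset (Finset α)), Disjoint P Q → A ⊆ P ∪ Q → D₅ ⊆ P \\ Q → D₂ ⊆ Q \\ P →
    (∀ d ∈ D₅ ∪ D₂, d ∉ (P \\ P) ∪ (Q \\ Q)) →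
    #(A ∪ D₅ ∪ D₂) ≤ #(((P ∪ Q) \\ A) ∪ (D₅ ∪ D₂) ∪ (P \\ D₅) ∪ (Q \\ D₂))

/-- **Conjecture (H1′)** (hp-7 gen 73), the minuend Hall form of (MS2).  An obligation, not a fact. -/
def MS2Hall' (α : Type*) [DecidableEq α] : Prop :=
  ∀ (P Q A D₅ D₂ : Finset (Finset α)), Disjoint P Q → A ⊆ P ∪ Q → D₅ ⊆ P \\ Q → D₂ ⊆ Q \\ P →
    (∀ d ∈ D₅ ∪ D₂, d ∉ (P \\ P) ∪ (Q \\ Q)) →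
    #(A ∪ D₅ ∪ D₂) ≤ #((A \\ (P ∪ Q)) ∪ (D₅ ∪ D₂) ∪ (P \\ D₅) ∪ (Q \\ D₂))

/-- Designated cross differences are differences of two members. -/
theorem designated_subset_diffs {P Q D₅ D₂ : Finset (Finset α)} (hD₅ : D₅ ⊆ P \\ Q) (hD₂ : D₂ ⊆ Q \\ P) :
    D₅ ∪ D₂ ⊆ (P ∪ Q) \\ (P ∪ Q) := by
  intro d hd
  rcases mem_union.mp hd with hd | hd
  · obtain ⟨a, ha, b, hb, rfl⟩ := mem_diffs.mp (hD₅ hd)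
    exact mem_diffs.mpr ⟨a, mem_union_left _ ha, b, mem_union_right _ hb, rfl⟩
  · obtain ⟨a, ha, b, hb, rfl⟩ := mem_diffs.mp (hD₂ hd)
    exact mem_diffs.mpr ⟨a, mem_union_right _ ha, b, mem_union_left _ hb, rfl⟩

/-- **(H2′) ⟹ (MS2)** (`A = F`). -/
theorem ms2_of_ms2Hall (h : MS2Hall α) : MS2 α := by
  intro P Q D₅ D₂ hPQ hD₅ hD₂ hpure
  have h1 := h P Q (P ∪ Q) D₅ D₂ hPQ subset_rfl hD₅ hD₂ hpure
  refine h1.trans (card_le_card ?_)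
  have hD := designated_subset_diffs hD₅ hD₂
  intro t ht
  simp only [mem_union] at ht ⊢
  rcases ht with ((ht | ht) | ht) | ht
  · exact Or.inl (Or.inl ht)
  · exact Or.inl (Or.inl (hD (mem_union.mpr ht)))
  · exact Or.inl (Or.inr ht)
  · exact Or.inr ht

/-- **(H1′) ⟹ (MS2)** (`A = F`). -/
theorem ms2_of_ms2Hall' (h : MS2Hall' α) : MS2 α := by
  intro P Q D₅ D₂ hPQ hD₅ hD₂ hpure
  have h1 := h P Q (P ∪ Q) D₅ D₂ hPQ subset_rfl hD₅ hD₂ hpure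
  refine h1.trans (card_le_card ?_)
  have hD := designated_subset_diffs hD₅ hD₂
  intro t ht
  simp only [mem_union] at ht ⊢
  rcases ht with ((ht | ht) | ht) | ht
  · exact Or.inl (Or.inl ht)
  · exact Or.inl (Or.inl (hD (mem_union.mpr ht)))
  · exact Or.inl (Or.inr ht)
  · exact Or.inr ht

/-- The TOPS of the designated type-5 differences: members `t ∈ P` realising some `d ∈ D₅` as `t \ q = d` (`q ∈ Q`). -/
def tops (P Q D : Finset (Finset α)) : Finset (Finset α) :=
  P.filter fun t => ∃ q ∈ Q, t \ q ∈ D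

/-- Tops are members of the block. -/
theorem tops_subset (P Q D : Finset (Finset α)) : tops P Q D ⊆ P := filter_subset _ _

/-- **Conjecture (MS2-tops)** (hp-7 gen 73): (MS2) with the second differences restricted to minuends that are tops of designated
differences of the same type.  An obligation, not a fact (0 failures in all tests; implies `MS2`). -/
def MS2Tops (α : Type*) [DecidableEq α] : Prop :=
  ∀ (P Q D₅ D₂ : Finset (Finset α)), Disjoint P Q → D₅ ⊆ P \\ Q → D₂ ⊆ Q \\ P →
    (∀ d ∈ D₅ ∪ D₂, d ∉ (P \\ P) ∪ (Q \\ Q)) →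
    #((P ∪ Q) ∪ D₅ ∪ D₂) ≤ #(((P ∪ Q) \\ (P ∪ Q)) ∪ (tops P Q D₅ \\ D₅) ∪ (tops Q P D₂ \\ D₂))

/-- **(MS2-tops) ⟹ (MS2)** (monotonicity of `\\` in the left factor). -/
theorem ms2_of_ms2Tops (h : MS2Tops α) : MS2 α := by
  intro P Q D₅ D₂ hPQ hD₅ hD₂ hpure
  refine (h P Q D₅ D₂ hPQ hD₅ hD₂ hpure).trans (card_le_card ?_)
  exact union_subset_union (union_subset_union subset_rfl (diffs_subset_right (tops_subset _ _ _)))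
    (diffs_subset_right (tops_subset _ _ _))

end HallForms

section NoGo

/-- The CORNER FORM of (MS2): only the corners `p ∩ q` of cross pairs realising a designated difference are used as witnesses. -/
def MS2Corner (α : Type*) [DecidableEq α] : Prop :=
  ∀ (P Q D₅ D₂ : Finset (Finset α)), Disjoint P Q → D₅ ⊆ P \\ Q → D₂ ⊆ Q \\ P →
    (∀ d ∈ D₅ ∪ D₂, d ∉ (P \\ P) ∪ (Q \\ Q)) →
    #((P ∪ Q) ∪ D₅ ∪ D₂) ≤ #(((P ∪ Q) \\ (P ∪ Q)) ∪
      ((P ×ˢ Q).filter fun pq => pq.1 \ pq.2 ∈ D₅ ∨ pq.2 \ pq.1 ∈ D₂).image fun pq => pq.1 ∩ pq.2)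

/-- **No-go (hp-7 gen 73): the corner form of (MS2) is false.**  Witness on `Fin 4`: the MS-tight twisted product
`P = {123, 124, 12}`, `Q = {2, 23, 24}` with `D₅ = {13, 14}` (both pure, top `12x`, all corners equal `{2}`): `#T = 7 < 8`.
((MS2) itself holds there: `124 \ 13 = 24` and `123 \ 14 = 23` are the needed second differences.) -/
theorem not_ms2Corner_fin4 : ¬ MS2Corner (Fin 4) := by
  intro h
  have := h ({({1, 2, 3} : Finset (Fin 4)), {1, 2, 0}, {1, 2}} : Finset (Finset (Fin 4)))
    ({({2} : Finset (Fin 4)), {2, 3}, {2, 0}} : Finset (Finset (Fin 4)))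
    ({({1, 3} : Finset (Fin 4)), {1, 0}} : Finset (Finset (Fin 4))) (∅ : Finset (Finset (Fin 4)))
    (by decide) (by decide) (by decide) (by decide)
  revert this
  decide

/-- **No-go for coordinate (sectioning) induction (hp-7 gen 73).**  The (MS2) instance `P = {{1,2}}`, `Q = {{0,1}}`, `D₅ = {{2}}`,
`D₂ = {{0}}` on `Fin 3` has term family `T = F \\ F ∪ P \\ D₅ ∪ Q \\ D₂ = {∅, {2}, {0}, {1}}` and `R = F ∪ D₅ ∪ D₂` of the same size
`4`, and for EVERY coordinate `i`: either `T` has fewer `i`-traces than `R`, or fewer `i`-pairs `{E, E ∪ {i}} ⊆ T` than `R` has.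
(Any sectioning proof at `i` would bound traces by traces and pairs by pairs.) -/
theorem ms2_sectioning_obstruction_fin3 :
    let T : Finset (Finset (Fin 3)) := {∅, {2}, {0}, {1}}
    let R : Finset (Finset (Fin 3)) := {{1, 2}, {0, 1}, {2}, {0}}
    (T = (({({1, 2} : Finset (Fin 3)), {0, 1}} : Finset (Finset (Fin 3))) \\ ({({1, 2} : Finset (Fin 3)), {0, 1}} : Finset _))
        ∪ (({({1, 2} : Finset (Fin 3))} : Finset (Finset (Fin 3))) \\ ({({2} : Finset (Fin 3))} : Finset _))
        ∪ (({({0, 1} : Finset (Fin 3))} : Finset (Finset (Fin 3))) \\ ({({0} : Finset (Fin 3))} : Finset _))) ∧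
    #T = #R ∧
    ∀ i : Fin 3,
      #(T.image fun E => E.erase i) < #(R.image fun E => E.erase i) ∨
      #(T.filter fun E => i ∉ E ∧ insert i E ∈ T) < #(R.filter fun E => i ∉ E ∧ insert i E ∈ R) := by
  decide

/-- **No-go (hp-7 gen 73, SAT kit `j275653`, model verified): the subtrahend Hall form (H2′) `MS2Hall` is FALSE on `2^[4]`.**
Witness (bit-strings `b₀b₁b₂b₃`): `P = {1100, 1110}`, `Q = {0100, 0010, 1001, 1101, 1011}`, `D₅ = {1000, 1010, 0110}`,
`D₂ = {0001, 0011}` (disjoint blocks, pure cross differences), `A = F \ {0100, 0010}`: the term family has `9` elements, `A ∪ D` has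
`10`.  (MS2) itself is tight there (margin `0`), and the minuend Hall form (H1′) `MS2Hall'` holds there (`12 ≥ 10`); for pairwise
intersecting non-covering ("dead-like") blocks (H2′) has no counterexample on `2^[≤5]` (same job).  So the injection behind (MS2), if
any, pays members by `a \ f`, not by `f \ a`. -/
theorem not_ms2Hall_fin4 : ¬ MS2Hall (Fin 4) := by
  intro h
  have := h ({({0, 1} : Finset (Fin 4)), {0, 1, 2}} : Finset (Finset (Fin 4)))
    ({({1} : Finset (Fin 4)), {2}, {0, 3}, {0, 1, 3}, {0, 2, 3}} : Finset (Finset (Fin 4)))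
    ({({0, 1} : Finset (Fin 4)), {0, 1, 2}, {0, 3}, {0, 1, 3}, {0, 2, 3}} : Finset (Finset (Fin 4)))
    ({({0} : Finset (Fin 4)), {0, 2}, {1, 2}} : Finset (Finset (Fin 4)))
    ({({3} : Finset (Fin 4)), {2, 3}} : Finset (Finset (Fin 4)))
    (by decide) (by decide) (by decide) (by decide) (by decide)
  revert this
  decide

end NoGo

end GeneratedDonors

end Summit.CriticalPhenomena.PercolationContinuityZ3.Theorems
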